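import Literature.AnabelianGeometry.EtaleTheta.ThetaRootOrbits
import Literature.AnabelianGeometry.EtaleTheta.Discharge.Sec2MonodromyModelTowerMembers
import HarnessLib

/-!
# [EtTh] §2 Def. 2.7 / Cor. 2.8 (i) at the MONODROMY TOY: the print-recipe orbit datum
# `MonodromyModel.thetaOrbitData l hl : ThetaOrbitData (monodromyModel l hl)` (DEF-BEARING, part A)

S. Mochizuki, *The étale theta function and its Frobenioid-theoretic manifestations* [EtTh], Publ. RIMS **45**
(2009), §1 Prop. 1.3 p. 14 (the étale theta class `η̈^Θ ∈ H¹(Π^tp_Ÿ, Δ_Θ)`), §2 Def. 2.7 p. 41 (the orbit collections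
`η̈^{Θ,ℤ×μ₂} ⊇ η̈^{Θ,l·ℤ×μ₂} ⊇ η̈^{Θ,l·ℤ}`, `η̲̈^{Θ,l·ℤ×μ₂} ⊇ η̲̈^{Θ,l·ℤ}`, «of standard type»), Cor. 2.8 (i) p. 42 (PRIMS
text pages) [cite: MochizukiEtTh2009, Def 2.7 p.41] [cite: MochizukiEtTh2009, Cor 2.8(i) p.42].  Cell `abc-iut`, F lane,
FACT-LIST row F-0640 `ThetaOrbitData.Cor28_i` (∀-closure REFUTED / schema, abc-iut-w4-d051 `not_forall_cor28_i`), seat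
abc-iut-f-128 (gen 14); abc-iut-L2-lead R1504 (L2 custody WELCOME, COUNT-NEUTRAL; DEF-BEARING → lane D).  DISTINCT route
from abc-iut-f-193's head-matched CONDITIONAL instances at `ofEmbedding` (`Cor28iHeadFormInstances.lean`, p537653), which
this file neither uses nor feeds.

THE CARRIER is abc-iut-w6-d084's MONODROMY MODEL `monodromyModel l hl : TemperedCoverData l` (every odd `l`;
`ThetaCoversMonodromyModel{Defs,Theta,Tempered,Aut}.lean`): `Π^tp_C = TG l = ((ℤ/l × ℤ/l) ⋊ D_∞) × ℤ/2` DISCRETE,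
coordinates `g = (((b, c), d), e)`, `D_∞ = ⟨t, ι⟩` acting by the unipotent monodromy `t·(b, c) = (b, c + b)` and the
inversion `ι·(b, c) = (−b, c)`; `Π^tp_Ÿ = {d = 1, e = 1} ≅ (ℤ/l)²`; the cusp inertia `z = ((0, 1), 1, 1)` generates
`Δ̄_Θ = {(0, c)}` and is CENTRAL; `Gal(Y/X) = Π^tp_X/Π^tp_Y ≅ ℤ` is the rotation index of `t`; `G_K = 1`.
HONEST LABEL (abc-iut-L2-lead R1352, verbatim): «a DESIGNED tempered toy with print's monodromy combinatorics — loop ↦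
`Δ̄^ell` (`b`-cycle), the inversion INVERTS it, unipotent monodromy `x ↦ x·z` on the `a`-cycle, `z` = cusp inertia = `Δ̄_Θ`
central; `G_K := 1`; NOT a Tate curve, NOT the tempered fundamental group of a curve; consistency ≠ faithfulness; nothing
here takes a side on anything printed.»

THE ORBIT DATUM (this file, §§1–3), filled by PRINT'S RECIPE rather than by junk:
* cyclotome `Δ_Θ := top/bot`, `top := Φ⁻¹(Δ̄_Θ) ∩ Π^tp_Ÿ = ⟨z⟩ ≅ ℤ/l` (`thetaTop`), `bot := 1`;
* the toy theta class `η₀ : Π^tp_Ÿ → Δ_Θ`, `(b, c) ↦ z^c` — the tautological class of the cusp inertia: `η₀|_{Δ_Θ} = id`,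
  as the Kummer class of a function with a simple zero restricts to the identity on the inertia of that cusp — and its
  translates/inverse `η_{ε,k} : (b, c) ↦ z^{ε c + k b}` (`etaFn ε k`); the `(Gal(Y/X) × μ₂)`-ORBIT of `η₀` is
  `η̈^{Θ,ℤ×μ₂} := {η_{±1,k} : k ∈ ℤ/l}` (`etaColl`, the 2l classes `{±(c + k·b)}`: conjugation by `t^k` is the shear
  `c ↦ c + k b`, see part B `etaFn_one_conj_tPow`), the `l·ℤ × μ₂`-orbit is `η̈^{Θ,l·ℤ×μ₂} := {η₀, η₀⁻¹}` (`etaCollL`;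
  `t^l` acts trivially on `Π^tp_Ÿ`), `η̈^{Θ,l·ℤ} := {η₀}` (`etaCollLZ`); each class is the singleton of its cocycle
  (the conjugation action on `Δ_Θ` is trivial, so coboundaries vanish and classes ARE singletons);
* `Dtau := {1}` — FORCED: `G_K = 1` and the interface's vacuity guard `Dtau_aug` (each `D` maps injectively to `G_K`)
  leave only the trivial decomposition group; `Π^tp_{Ÿ̲̲} = Π^tp_Ÿ ∩ Π^tp_{X̲̲} = 1` in the toy (its `X̲̲` is the loop
  alone), so the root collections are the singleton of the trivial cocycle (`rootColl`).
DEGENERATE where the toy is degenerate (`G_K = 1`, `Π^tp_{Ÿ̲̲} = 1`), GENUINE in the `Γ`-quantifier of Cor. 2.8 (i):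
part B (`ThetaRootOrbitsMonodromyToyCor28i.lean`, PROOF-ONLY) shows `IsStandard`, clauses C1–C3 of the typed `Cor28_i`
for EVERY topological automorphism `Γ` of `Π^tp_C` («constant multiple rigidity at the toy»: an admissible `(Γ, Γ_Θ)`
permutes the 2l classes because `η|_{Δ_Θ} = ±id` pins the orbit and `Γ_Θ` is `Γ`-induced), and that clause C4 FAILS
for `γ_t` — `t ∈ Π^tp_{C̲}` in the toy, whose `X̲ → X` kills the `a`-cycle so that Def. 2.5 (i)(a) `Π^tp_Y ⊆ Π^tp_{X̲}`
is FALSE and Rmk. 2.1.1's non-Galois obstruction is absent — hence `¬ (thetaOrbitData l hl).Cor28_i`.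

DEF-BEARING (class (b) MODEL/CONSTRUCTION: definitions over the NEW carrier only; abc-iut-L2-t2's interface
`ThetaOrbitData` and abc-iut-w6-d084's `monodromyModel` are INSTANTIATED, never edited; 0 `instance`, 0 notation).
What this is NOT: not the natural instance `ofEmbedding` at the cover of record (whose unconditional `Cor28_i` is the
parked question (E) «AUT-CLASSIFICATION @ modelχ′», abc-iut-L2-lead R1429); a statement about OUR typed predicate at a
designed toy, not about [EtTh] Cor. 2.8 (i) in print (a refereed theorem); refutable-as-typed-at-a-design-carrier ≠ refuted
in print; no bearing on [IUTchIII] Cor. 3.12; no side taken; typed ≠ proved.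
-/

noncomputable section

namespace Literature.AnabelianGeometry.EtaleTheta.ThetaCovers.MonodromyModel

open Multiplicative HeisenbergWitness TemperedModel DihedralGroup

variable (l : ℕ)

/-! ## 1. The cyclotome `Δ_Θ = ⟨z⟩ ⊆ Π^tp_Ÿ` of the toy -/

/-- **`top := Φ⁻¹(Δ̄_Θ) ∩ Π^tp_Ÿ = {b = 0, d = 1, e = 1} = ⟨z⟩`** — the cusp inertia inside `Π^tp_Ÿ` (the toy's
«inverse image of `Δ_Θ ⊆ (Δ^tp_X)^Θ`»; `bot := 1`). (toy bookkeeping for the typed interface of [EtTh] Def. 2.7; no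
claim about print) [cite: MochizukiEtTh2009, Def 2.7 p.41] -/
def thetaTop : Subgroup (TG l) := (heisTheta l).comap (PhiT l) ⊓ PiYddT l

/-- Membership in `top`: `b = 0`, `d = 1`, `e = 1`. (toy bookkeeping) [cite: MochizukiEtTh2009, Def 2.7 p.41] -/
theorem mem_thetaTop_iff (g : TG l) : g ∈ thetaTop l ↔ bC l g = 0 ∧ g.1.right = 1 ∧ g.2 = 1 := by
  rw [thetaTop, Subgroup.mem_inf, Subgroup.mem_comap, mem_heisTheta, mem_PiYddT_iff]
  constructor
  · rintro ⟨⟨_, hb⟩, hd, he⟩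
    exact ⟨hb, hd, he⟩
  · rintro ⟨hb, hd, he⟩
    refine ⟨⟨?_, hb⟩, hd, he⟩
    show dihedralRed l g.1.right = 1
    rw [hd, map_one]

/-- `top ⊆ Π^tp_Ÿ`. (toy bookkeeping) [cite: MochizukiEtTh2009, Def 2.7 p.41] -/
theorem thetaTop_le_PiYddT : thetaTop l ≤ PiYddT l := inf_le_right

/-- `Π^tp_Ÿ = {d = 1, e = 1}` is normal in `Π^tp_C` (intersection of two kernels). (toy bookkeeping)
[cite: MochizukiEtTh2009, Def 2.5 p.39] -/
theorem PiYddT_normal : (PiYddT l).Normal := by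
  haveI h1 : (PiYT l).Normal := MonoidHom.normal_ker _
  haveI h2 : (TG.snd l).ker.Normal := MonoidHom.normal_ker _
  exact Subgroup.normal_inf_normal (PiYT l) (TG.snd l).ker

/-- `top = ⟨z⟩` is normal in `Π^tp_C` (indeed central, part B). (toy bookkeeping) [cite: MochizukiEtTh2009, Def 2.7 p.41] -/
theorem thetaTop_normal : (thetaTop l).Normal := by
  haveI h1 : ((heisTheta l).comap (PhiT l)).Normal := (heisTheta_normal l).comap _
  haveI h2 : (PiYddT l).Normal := PiYddT_normal l
  exact Subgroup.normal_inf_normal _ _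

/-- **The generator map `ℤ/l → top`, `c ↦ z^c = (((0, c), 1), 1)`** (a bijective homomorphism, part B).
(toy bookkeeping) [cite: MochizukiEtTh2009, Def 2.7 p.41] -/
def thetaGen : Multiplicative (ZMod l) →* ↥(thetaTop l) :=
  ((embCu l).comp (MonoidHom.inl (Multiplicative (ZMod l)) (DihedralGroup 0))).codRestrict (thetaTop l) fun _ =>
    (mem_thetaTop_iff l _).mpr ⟨bC_embCu l _, embCu_right l _, embCu_snd l _⟩

/-- Coordinates of `z^c`. (toy bookkeeping) [cite: MochizukiEtTh2009, Def 2.7 p.41] -/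
@[simp] theorem coe_thetaGen (c : Multiplicative (ZMod l)) : (thetaGen l c : TG l) = embCu l (c, 1) := rfl

/-- **The cusp inertia generator `z = (((0, 1), 1), 1)`** («`Δ̄_Θ = ⟨z⟩`», central). (toy bookkeeping)
[cite: MochizukiEtTh2009, Def 2.7 p.41] -/
def zT : TG l := embCu l (ofAdd 1, 1)

/-- `z ∈ top`. (toy bookkeeping) [cite: MochizukiEtTh2009, Def 2.7 p.41] -/
theorem zT_mem_thetaTop : zT l ∈ thetaTop l := (thetaGen l (ofAdd 1)).2

/-- **The loop `t = r 1 ∈ D_∞`** as an element of `Π^tp_C` (`t = ((0, 0), r 1, 1)`; its rotation index generates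
`Gal(Y/X) = Π^tp_X/Π^tp_Y ≅ ℤ`). (toy bookkeeping) [cite: MochizukiEtTh2009, §1 p.12] -/
def tT : TG l := embCu l (1, r 1)

/-- **The lift `x₀ = (((1, 0), 1), 1) ∈ Π^tp_Ÿ` of the `a`-cycle** (`Π^tp_Ÿ = ⟨x₀⟩ × ⟨z⟩`). (toy bookkeeping)
[cite: MochizukiEtTh2009, Def 2.5 p.39] -/
def xT : TG l := xElt l 1

/-- The coefficient type `Δ_Θ = top/bot` of the toy datum (`bot = 1`). (toy bookkeeping) [cite: MochizukiEtTh2009, Def 2.7 p.41] -/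
abbrev DTh : Type := ↥(thetaTop l) ⧸ (⊥ : Subgroup (TG l)).subgroupOf (thetaTop l)

/-- `ℤ/l → Δ_Θ`, `c ↦ [z^c]` (bijective, multiplicative — part B). (toy bookkeeping) [cite: MochizukiEtTh2009, Def 2.7 p.41] -/
def thetaCoeff (c : Multiplicative (ZMod l)) : DTh l := QuotientGroup.mk (thetaGen l c)

/-! ## 2. The toy theta class and the print-recipe orbit collections -/

/-- **`η_{ε,k} : Π^tp_Ÿ → Δ_Θ`, `(b, c) ↦ [z^{ε c + k b}]`** — for `ε = 1`, `k = 0` the toy theta class `η₀` (tautological on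
the cusp inertia: `η₀|_{Δ_Θ} = id`); `η_{1,k} = η₀ ∘ conj(t^k)` are its `Gal(Y/X)`-translates and `η_{−1,k}` their inverses
(part B). (toy bookkeeping for [EtTh] Prop. 1.3 / Def. 2.7; no claim about print) [cite: MochizukiEtTh2009, Def 2.7 p.41] -/
def etaFn (ε k : ZMod l) : ↥(PiYddT l) → DTh l := fun g => thetaCoeff l (ofAdd (ε * cC l g + k * bC l g))

/-- Unfolding `η_{ε,k}`. (toy bookkeeping) [cite: MochizukiEtTh2009, Def 2.7 p.41] -/
theorem etaFn_apply (ε k : ZMod l) (g : ↥(PiYddT l)) :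
    etaFn l ε k g = thetaCoeff l (ofAdd (ε * cC l g + k * bC l g)) := rfl

/-- **`η̈^{Θ,ℤ×μ₂} := {η_{±1,k} : k ∈ ℤ/l}`**, the `(Gal(Y/X) × μ₂)`-orbit of the toy theta class — `2l` singleton classes
`{±(c + k·b)}` (print's recipe: translates by `Π^tp_X/Π^tp_Y ≅ ℤ` and inversion). (toy bookkeeping for [EtTh] Def. 2.7;
no claim about print) [cite: MochizukiEtTh2009, Def 2.7 p.41] -/
def etaColl : Set (Set (↥(PiYddT l) → DTh l)) := {c | ∃ ε k : ZMod l, (ε = 1 ∨ ε = -1) ∧ c = {etaFn l ε k}}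

/-- **`η̈^{Θ,l·ℤ×μ₂} := {η₀, η₀⁻¹}`**, the `(l·ℤ × μ₂)`-orbit (`t^l` acts trivially on `Π^tp_Ÿ = (ℤ/l)²`). (toy bookkeeping
for [EtTh] Def. 2.7; no claim about print) [cite: MochizukiEtTh2009, Def 2.7 p.41] -/
def etaCollL : Set (Set (↥(PiYddT l) → DTh l)) := { {etaFn l 1 0}, {etaFn l (-1) 0} }

/-- **`η̈^{Θ,l·ℤ} := {η₀}`**. (toy bookkeeping for [EtTh] Def. 2.7; no claim about print) [cite: MochizukiEtTh2009, Def 2.7 p.41] -/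
def etaCollLZ : Set (Set (↥(PiYddT l) → DTh l)) := { {etaFn l 1 0} }

/-- `η̈^{Θ,l·ℤ} ⊆ η̈^{Θ,l·ℤ×μ₂} ⊆ η̈^{Θ,ℤ×μ₂}`. (toy bookkeeping) [cite: MochizukiEtTh2009, Def 2.7 p.41] -/
theorem etaColl_sub : etaCollLZ l ⊆ etaCollL l ∧ etaCollL l ⊆ etaColl l := by
  refine ⟨fun c hc => ?_, fun c hc => ?_⟩
  · rw [etaCollLZ, Set.mem_singleton_iff] at hc
    exact Or.inl hc
  · rcases hc with rfl | hc
    · exact ⟨1, 0, Or.inl rfl, rfl⟩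
    · rw [Set.mem_singleton_iff] at hc
      exact ⟨-1, 0, Or.inr rfl, hc⟩

/-! ## 3. The orbit datum over `monodromyModel l hl` -/

section Model

variable [NeZero l] (hl : Odd l)

/-- `Π^tp_{Ÿ̲̲} = Π^tp_Ÿ ∩ Π^tp_{X̲̲} = {b = c = 0, d = 1, e = 1} = 1` in the toy (its `X̲̲` is the loop `⟨t⟩` alone).
(toy bookkeeping for [EtTh] Def. 2.7 «`Π^tp_{Ÿ̲̲}`»; no claim about print) [cite: MochizukiEtTh2009, Def 2.7 p.41] -/
theorem PiYddT_inf_tp_PiXuu_eq_bot :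
    PiYddT l ⊓ (monodromyModel l hl).tp (monodromyModel l hl).PiXuu = ⊥ := by
  rw [tp_PiXuu l hl, Subgroup.comap_inf, eq_bot_iff]
  intro g hg
  rw [Subgroup.mem_inf, mem_PiYddT_iff, Subgroup.mem_inf, (mem_members_iff l g).2.1] at hg
  rw [Subgroup.mem_bot]
  exact TG.ext l hg.1.1 hg.2.1.1 hg.2.1.2 hg.1.2

/-- The trivial root cocycle on `Π^tp_{Ÿ̲̲} = 1` (the `l`-th root of `η₀|_{Ÿ̲̲} = 1`). (toy bookkeeping for [EtTh] Def. 2.7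
«`η̲̈^Θ`»; no claim about print) [cite: MochizukiEtTh2009, Def 2.7 p.41] -/
def rootFn : ↥(PiYddT l ⊓ (monodromyModel l hl).tp (monodromyModel l hl).PiXuu) → DTh l := fun _ => thetaCoeff l 1

/-- **`η̲̈^{Θ,l·ℤ×μ₂} = η̲̈^{Θ,l·ℤ} := {1}`** — the root collections on the trivial group `Π^tp_{Ÿ̲̲}` (DEGENERATE in the toy).
(toy bookkeeping for [EtTh] Def. 2.7; no claim about print) [cite: MochizukiEtTh2009, Def 2.7 p.41] -/
def rootColl : Set (Set (↥(PiYddT l ⊓ (monodromyModel l hl).tp (monodromyModel l hl).PiXuu) → DTh l)) :=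
  { {rootFn l hl} }

/-- `η₀` is trivial on `Π^tp_{Ÿ̲̲} = 1`: `(root)^l = 1 = η₀|_{Ÿ̲̲}`. (toy bookkeeping) [cite: MochizukiEtTh2009, Def 2.7 p.41] -/
theorem etaFn_one_zero_apply_of_mem_inf (g : ↥(PiYddT l ⊓ (monodromyModel l hl).tp (monodromyModel l hl).PiXuu)) :
    etaFn l 1 0 ⟨g, g.2.1⟩ = thetaCoeff l 1 := by
  have hg : (g : TG l) = 1 := by
    have h : (g : TG l) ∈ (⊥ : Subgroup (TG l)) := by
      rw [← PiYddT_inf_tp_PiXuu_eq_bot l hl]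
      exact g.2
    exact Subgroup.mem_bot.mp h
  rw [etaFn_apply]
  congr 1
  apply toAdd.injective
  rw [toAdd_ofAdd, toAdd_one, one_mul, zero_mul, add_zero]
  show cC l (g : TG l) = 0
  rw [hg]
  rfl

/-- **THE PRINT-RECIPE ORBIT DATUM AT THE MONODROMY TOY** — `Δ_Θ := ⟨z⟩/1`, `Dtau := {1}` (forced by `G_K = 1`),
`η̈^{Θ,ℤ×μ₂} := (Gal(Y/X) × μ₂)·η₀` (2l classes), `η̈^{Θ,l·ℤ×μ₂} := {η₀^{±1}}`, `η̈^{Θ,l·ℤ} := {η₀}`, roots `:= {1}` on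
`Π^tp_{Ÿ̲̲} = 1`.  HONEST LABEL: R1352 DESIGNED TOY (header); DEGENERATE in the `G_K`/`±1`/root directions, GENUINE in the
`Γ`-quantifier; consistency/inconsistency evidence about the TYPED interface only; nothing about [EtTh] in print.
(`@[reducible]`, like `monodromyModel`, so that the fields unfold for instance search downstream.)
[cite: MochizukiEtTh2009, Def 2.7 p.41] -/
@[reducible] def thetaOrbitData : ThetaOrbitData (monodromyModel l hl) where
  top := thetaTop l
  bot := ⊥
  bot_le := bot_le
  top_normal := thetaTop_normal l
  bot_normal := inferInstance
  top_le := le_inf (thetaTop_le_PiYddT l) fun _ _ => MonoidHom.mem_ker.mpr (Subsingleton.elim _ _)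
  Dtau := {⊥}
  Dtau_le := by
    intro D hD
    rw [Set.mem_singleton_iff] at hD
    rw [hD]
    exact bot_le
  Dtau_nonempty := ⟨⊥, rfl⟩
  Dtau_aug := by
    intro D hD
    rw [Set.mem_singleton_iff] at hD
    subst hD
    refine ⟨?_, ?_⟩
    · rw [Subgroup.coe_bot]
      exact Set.injOn_singleton _ _
    · rw [Subgroup.map_bot]
      infer_instance
  etaZMu2 := etaColl l
  etaLZMu2 := etaCollL l
  etaLZ := etaCollLZ l
  etaLZ_sub := etaColl_sub l
  rootLZMu2 := rootColl l hl
  rootLZ := rootColl l hl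
  rootLZ_sub := subset_rfl
  root_pow := by
    intro c hc ξ hξ
    rw [rootColl, Set.mem_singleton_iff] at hc
    subst hc
    rw [Set.mem_singleton_iff] at hξ
    subst hξ
    refine ⟨{etaFn l 1 0}, Or.inl rfl, etaFn l 1 0, rfl, fun g => ?_⟩
    rw [etaFn_one_zero_apply_of_mem_inf l hl g]
    show (QuotientGroup.mk (thetaGen l 1) : DTh l) ^ l = QuotientGroup.mk (thetaGen l 1)
    simp only [map_one, QuotientGroup.mk_one, one_pow]

/-- The fields of the datum, definitionally. (toy bookkeeping) [cite: MochizukiEtTh2009, Def 2.7 p.41] -/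
theorem thetaOrbitData_top : (thetaOrbitData l hl).top = thetaTop l := rfl

/-- The fields of the datum, definitionally. (toy bookkeeping) [cite: MochizukiEtTh2009, Def 2.7 p.41] -/
theorem thetaOrbitData_bot : (thetaOrbitData l hl).bot = ⊥ := rfl

/-- The fields of the datum, definitionally. (toy bookkeeping) [cite: MochizukiEtTh2009, Def 1.9 p.29] -/
theorem thetaOrbitData_Dtau : (thetaOrbitData l hl).Dtau = {⊥} := rfl

/-- The fields of the datum, definitionally. (toy bookkeeping) [cite: MochizukiEtTh2009, Def 2.7 p.41] -/
theorem thetaOrbitData_etaZMu2 : (thetaOrbitData l hl).etaZMu2 = etaColl l := rfl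

/-- The fields of the datum, definitionally. (toy bookkeeping) [cite: MochizukiEtTh2009, Def 2.7 p.41] -/
theorem thetaOrbitData_etaLZMu2 : (thetaOrbitData l hl).etaLZMu2 = etaCollL l := rfl

/-- The fields of the datum, definitionally. (toy bookkeeping) [cite: MochizukiEtTh2009, Def 2.7 p.41] -/
theorem thetaOrbitData_etaLZ : (thetaOrbitData l hl).etaLZ = etaCollLZ l := rfl

/-- The fields of the datum, definitionally. (toy bookkeeping) [cite: MochizukiEtTh2009, Def 2.7 p.41] -/
theorem thetaOrbitData_rootLZMu2 : (thetaOrbitData l hl).rootLZMu2 = rootColl l hl := rfl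

/-- The fields of the datum, definitionally. (toy bookkeeping) [cite: MochizukiEtTh2009, Def 2.7 p.41] -/
theorem thetaOrbitData_rootLZ : (thetaOrbitData l hl).rootLZ = rootColl l hl := rfl

/-- The coefficient module of the datum is the toy's `Δ_Θ = ⟨z⟩/1`, definitionally. (toy bookkeeping)
[cite: MochizukiEtTh2009, Def 2.7 p.41] -/
theorem thetaOrbitData_DeltaTheta : (thetaOrbitData l hl).DeltaTheta = DTh l := rfl

end Model

end Literature.AnabelianGeometry.EtaleTheta.ThetaCovers.MonodromyModel

end
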